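import Mathlib
import Literature.MathematicalPhysics.StatisticalMechanics.BarlowStacking
import HarnessLib

/-!
# Every close-packed bilayer of a Barlow stacking is an fcc bilayer (up to a basal mirror and a translation)

Topic `Literature/MathematicalPhysics/StatisticalMechanics`; companion of `BarlowStacking.lean`
(`barlowStacking a h s`, layers `barlowLayer a h s k` = the triangular lattice shifted by
`(haggLabel s k)·w` in the plane `x₃ = k h`, `fccStacking a h = barlowStacking a h constHagg`).

A Barlow stacking (Hägg word `s ∈ {±1}^ℤ`) is locally fcc bilayer by bilayer: the two consecutive
layers `k`, `k + 1` differ by the lateral shift `s k · w`, exactly as the layers `k`, `k + 1` of the fcc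
stacking `…ABC…` (`s ≡ +1`) or of its basal mirror image `…CBA…` (`s ≡ −1`) do.  Hence

* `barlowBilayer_subset_fcc_of_eq_one` — if `s k = 1`, layers `k, k+1` lie in the translate of
  `fccStacking a h` by `(haggLabel s k − k)·w`;
* `barlowBilayer_subset_mirror_fcc_of_eq_neg_one` — if `s k = −1`, they lie in the translate by
  `(haggLabel s k + k)·w` of the BASAL MIRROR IMAGE `basalMirror '' fccStacking a h`
  (`basalMirror` = the reflection `x₃ ↦ −x₃`, a linear isometry);
* `exists_isometry_barlowBilayer_subset_fcc` — for a Hägg sequence, every bilayer lies in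
  `A '' fccStacking a h + u` for some linear isometry `A` and vector `u` (the fcc FRAME of the
  bilayer, unique up to the stabiliser of the fcc lattice);
* `sep_barlowStacking_height` — the bilayer as the height slice
  `{r ∈ barlowStacking a h s | r₃ = k h ∨ r₃ = (k+1) h}` (`h ≠ 0`), and the MOVED form
  `exists_isometry_movedBilayer_subset_fcc` (bilayers of `L · + s₀` lie in moved fcc lattices) —
  the shape of the frame-table hypothesis of `BarlowFreeCertificate` (`a = 1`, `h = √(2/3)`);
* (hollow classes) `twelve_mul_norm_inPlane_sq`, `norm_inPlane_ne_of_not_dvd` — a vector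
  `P u + Q v + Λ' w` joining two DIFFERENT hollow classes of one layer plane (`3 ∤ Λ'`) never has
  length `a` (its squared length lies in `a² (ℕ + 1/3)`, `sq_div_three_le_norm_inPlane_sq`): balls of
  one layer plane over different hollow sublattices never touch; Barlow form
  `dist_barlowPos_ne_of_haggLabel_not_congr`.

[cite: ConwaySloane1999, Ch. 1 §1.3 (Barlow packings: any two consecutive layers are congruent to
two consecutive fcc layers)]; [cite: HalesDSP2012, §1.3 (labels `A, B, C`; the FCC and HCP patterns)];
[cite: FlatleyTheil2015, §3.2 Def. 3.8 and the remark before it (fcc and hcp decompose, between two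
consecutive layers, into the same units)].  Consumed by the Barlow tent (`BarlowFreeCertificate` of
`Summits/Ventures/Crystal3D`, route StickyWulffConstant, TexShadow v6.1): the table of bilayer frames.
-/

noncomputable section

open Set
open scoped RealInnerProductSpace

namespace Literature.MathematicalPhysics.StatisticalMechanics

/-! ## The basal mirror -/

/-- **The basal mirror** `x₃ ↦ −x₃`: the reflection in the close-packed plane `x₃ = 0`, as a linear
isometry of `ℝ³` (the reflection in the orthogonal complement of the stacking axis).
[cite: ConwaySloane1999, Ch. 1 §1.3] -/
def basalMirror : EuclideanSpace ℝ (Fin 3) ≃ₗᵢ[ℝ] EuclideanSpace ℝ (Fin 3) :=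
  (ℝ ∙ (EuclideanSpace.single (2 : Fin 3) (1 : ℝ)))ᗮ.reflection

/-- The basal mirror negates the third coordinate and fixes the other two.
[cite: ConwaySloane1999, Ch. 1 §1.3] -/
theorem basalMirror_apply_coord (x : EuclideanSpace ℝ (Fin 3)) (t : Fin 3) :
    basalMirror x t = if t = 2 then -x 2 else x t := by
  rw [basalMirror, Submodule.reflection_orthogonal_apply, Submodule.reflection_singleton_apply,
    EuclideanSpace.inner_single_left]
  have hn : ‖(EuclideanSpace.single (2 : Fin 3) (1 : ℝ))‖ = 1 := by simp
  rw [hn]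
  fin_cases t
  · simp
  · simp
  · simp; ring

/-- The mirror fixes the in-plane vectors `u, v, w` and negates the layer normal. [folklore] -/
private theorem basalMirror_frame (a h : ℝ) :
    basalMirror (triangularVec₁ a) = triangularVec₁ a ∧ basalMirror (triangularVec₂ a) = triangularVec₂ a ∧
      basalMirror (barlowOffset a) = barlowOffset a ∧ basalMirror (layerNormal h) = -layerNormal h := by
  refine ⟨?_, ?_, ?_, ?_⟩ <;> ext t <;> rw [basalMirror_apply_coord] <;>
    fin_cases t <;> simp [triangularVec₁, triangularVec₂, barlowOffset, layerNormal]

/-- The mirror image of the fcc point `(m, i, j)` is `i u + j v + m w − m h e₃`.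
[cite: ConwaySloane1999, Ch. 1 §1.3] -/
theorem basalMirror_barlowPos_constHagg (a h : ℝ) (m i j : ℤ) :
    basalMirror (barlowPos a h constHagg m i j) =
      (i : ℝ) • triangularVec₁ a + (j : ℝ) • triangularVec₂ a + (m : ℝ) • barlowOffset a -
        (m : ℝ) • layerNormal h := by
  obtain ⟨h1, h2, h3, h4⟩ := basalMirror_frame a h
  simp only [barlowPos, haggLabel_const, map_add, LinearIsometryEquiv.map_smul, h1, h2, h3, h4,
    smul_neg]
  abel

/-! ## Bilayers are fcc bilayers -/

/-- **Step `+1`: the bilayer is an fcc bilayer up to translation.**  If `s k = 1` then layers `k` and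
`k + 1` of the Barlow stacking lie in the translate of the fcc stacking by `(haggLabel s k − k)·w`
(indeed they ARE its layers `k`, `k + 1`). [cite: ConwaySloane1999, Ch. 1 §1.3];
[cite: HalesDSP2012, §1.3] -/
theorem barlowBilayer_subset_fcc_of_eq_one (a h : ℝ) (s : ℤ → ℤ) (k : ℤ) (hk : s k = 1) :
    barlowLayer a h s k ∪ barlowLayer a h s (k + 1) ⊆
      (fun r => r + ((haggLabel s k : ℝ) - k) • barlowOffset a) '' fccStacking a h := by
  have hL : (haggLabel s (k + 1) : ℝ) = haggLabel s k + 1 := by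
    rw [haggLabel_succ, hk]; push_cast; ring
  rintro x (⟨i, j, rfl⟩ | ⟨i, j, rfl⟩)
  · refine ⟨barlowPos a h constHagg k i j, barlowPos_mem k i j, ?_⟩
    simp only [barlowPos, haggLabel_const]
    module
  · refine ⟨barlowPos a h constHagg (k + 1) i j, barlowPos_mem (k + 1) i j, ?_⟩
    simp only [barlowPos, haggLabel_const, hL]
    push_cast
    module

/-- **Step `−1`: the bilayer is a MIRRORED fcc bilayer up to translation.**  If `s k = −1` then layers
`k` and `k + 1` lie in the translate by `(haggLabel s k + k)·w` of the basal mirror image of the fcc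
stacking. [cite: ConwaySloane1999, Ch. 1 §1.3]; [cite: HalesDSP2012, §1.3] -/
theorem barlowBilayer_subset_mirror_fcc_of_eq_neg_one (a h : ℝ) (s : ℤ → ℤ) (k : ℤ)
    (hk : s k = -1) :
    barlowLayer a h s k ∪ barlowLayer a h s (k + 1) ⊆
      (fun r => basalMirror r + ((haggLabel s k : ℝ) + k) • barlowOffset a) '' fccStacking a h := by
  have hL : (haggLabel s (k + 1) : ℝ) = haggLabel s k - 1 := by
    rw [haggLabel_succ, hk]; push_cast; ring
  rintro x (⟨i, j, rfl⟩ | ⟨i, j, rfl⟩)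
  · refine ⟨barlowPos a h constHagg (-k) i j, barlowPos_mem (-k) i j, ?_⟩
    show basalMirror (barlowPos a h constHagg (-k) i j) + _ = _
    rw [basalMirror_barlowPos_constHagg]
    simp only [barlowPos]
    push_cast
    module
  · refine ⟨barlowPos a h constHagg (-(k + 1)) i j, barlowPos_mem (-(k + 1)) i j, ?_⟩
    show basalMirror (barlowPos a h constHagg (-(k + 1)) i j) + _ = _
    rw [basalMirror_barlowPos_constHagg]
    simp only [barlowPos, hL]
    push_cast
    module

/-- **Every bilayer of a Barlow stacking has an fcc frame**: for a Hägg sequence `s` and every `k`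
there are a linear isometry `A` (the identity or the basal mirror) and a vector `u` with
`layer k ∪ layer (k+1) ⊆ A '' fccStacking + u`. [cite: ConwaySloane1999, Ch. 1 §1.3 (Barlow packings)];
[cite: FlatleyTheil2015, §3.2 (the space between two consecutive layers of fcc or hcp decomposes into
the same units)] -/
theorem exists_isometry_barlowBilayer_subset_fcc (a h : ℝ) {s : ℤ → ℤ} (hs : IsHaggSeq s) (k : ℤ) :
    ∃ (A : EuclideanSpace ℝ (Fin 3) ≃ₗᵢ[ℝ] EuclideanSpace ℝ (Fin 3)) (u : EuclideanSpace ℝ (Fin 3)),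
      barlowLayer a h s k ∪ barlowLayer a h s (k + 1) ⊆ (fun r => A r + u) '' fccStacking a h := by
  rcases hs k with hk | hk
  · exact ⟨LinearIsometryEquiv.refl ℝ _, ((haggLabel s k : ℝ) - k) • barlowOffset a,
      by simpa using barlowBilayer_subset_fcc_of_eq_one a h s k hk⟩
  · exact ⟨basalMirror, ((haggLabel s k : ℝ) + k) • barlowOffset a,
      barlowBilayer_subset_mirror_fcc_of_eq_neg_one a h s k hk⟩

/-! ## Bilayers as height slices -/

/-- A point of the stacking lies in layer `k` iff its height is `k h` (`h ≠ 0`): the layers are the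
planes `x₃ = k h`. [cite: HalesDSP2012, §1.3 (layers of the FCC and HCP patterns)] -/
theorem mem_barlowLayer_iff_apply_two {a h : ℝ} (hh : h ≠ 0) {s : ℤ → ℤ}
    {x : EuclideanSpace ℝ (Fin 3)} (hx : x ∈ barlowStacking a h s) (k : ℤ) :
    x ∈ barlowLayer a h s k ↔ x 2 = k * h := by
  obtain ⟨k', i, j, rfl⟩ := hx
  rw [barlowPos_apply_two]
  constructor
  · rintro ⟨i', j', hx'⟩
    have := congrArg (fun y : EuclideanSpace ℝ (Fin 3) => y 2) hx'
    simpa [barlowPos_apply_two] using this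
  · intro hk
    have : (k' : ℝ) = k := mul_right_cancel₀ hh hk
    have hkk : k' = k := by exact_mod_cast this
    subst hkk
    exact ⟨i, j, rfl⟩

/-- **The bilayer as a height slice**: for `h ≠ 0`,
`{r ∈ barlowStacking a h s | r₃ = k h ∨ r₃ = (k+1) h} = layer k ∪ layer (k+1)`.
[cite: HalesDSP2012, §1.3] -/
theorem sep_barlowStacking_height {a h : ℝ} (hh : h ≠ 0) (s : ℤ → ℤ) (k : ℤ) :
    {r | r ∈ barlowStacking a h s ∧ (r 2 = (k : ℝ) * h ∨ r 2 = ((k : ℝ) + 1) * h)} =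
      barlowLayer a h s k ∪ barlowLayer a h s (k + 1) := by
  ext r
  simp only [Set.mem_setOf_eq, Set.mem_union]
  constructor
  · rintro ⟨hr, h1 | h2⟩
    · exact Or.inl ((mem_barlowLayer_iff_apply_two hh hr k).mpr h1)
    · refine Or.inr ((mem_barlowLayer_iff_apply_two hh hr (k + 1)).mpr ?_)
      push_cast; exact h2
  · rintro (h1 | h2)
    · have hr : r ∈ barlowStacking a h s := by
        obtain ⟨i, j, rfl⟩ := h1; exact barlowPos_mem k i j
      exact ⟨hr, Or.inl ((mem_barlowLayer_iff_apply_two hh hr k).mp h1)⟩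
    · have hr : r ∈ barlowStacking a h s := by
        obtain ⟨i, j, rfl⟩ := h2; exact barlowPos_mem (k + 1) i j
      refine ⟨hr, Or.inr ?_⟩
      have := (mem_barlowLayer_iff_apply_two hh hr (k + 1)).mp h2
      push_cast at this; exact this

/-- **Moved form** (the shape of the frame-table hypothesis of the Barlow tent): for a Hägg sequence,
every height-slice bilayer of a MOVED stacking `L · + s₀` lies in a moved fcc lattice `A · + u`.
[cite: ConwaySloane1999, Ch. 1 §1.3]; [cite: FlatleyTheil2015, §3.2] -/
theorem exists_isometry_movedBilayer_subset_fcc {a h : ℝ} (hh : h ≠ 0) {s : ℤ → ℤ}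
    (hs : IsHaggSeq s) (L : EuclideanSpace ℝ (Fin 3) ≃ₗᵢ[ℝ] EuclideanSpace ℝ (Fin 3))
    (s₀ : EuclideanSpace ℝ (Fin 3)) (k : ℤ) :
    ∃ (A : EuclideanSpace ℝ (Fin 3) ≃ₗᵢ[ℝ] EuclideanSpace ℝ (Fin 3)) (u : EuclideanSpace ℝ (Fin 3)),
      (fun r => L r + s₀) '' {r | r ∈ barlowStacking a h s ∧ (r 2 = (k : ℝ) * h ∨ r 2 = ((k : ℝ) + 1) * h)}
        ⊆ (fun r => A r + u) '' fccStacking a h := by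
  rw [sep_barlowStacking_height hh s k]
  obtain ⟨A₀, u₀, hsub⟩ := exists_isometry_barlowBilayer_subset_fcc a h hs k
  refine ⟨A₀.trans L, L u₀ + s₀, ?_⟩
  rintro _ ⟨r, hr, rfl⟩
  obtain ⟨q, hq, hqr⟩ := hsub hr
  refine ⟨q, hq, ?_⟩
  simp only [LinearIsometryEquiv.trans_apply] at hqr ⊢
  rw [← hqr, map_add]
  abel

/-! ## Hollow classes: two sublattice classes of one layer plane never touch

The three «hollow classes» of a close-packed plane are the cosets `Λ + c w` (`c mod 3`) of the
triangular lattice `Λ = ℤu + ℤv`; a vector `P u + Q v + Λ' w` joining points of DIFFERENT classes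
(`3 ∤ Λ'`) has `12 ‖·‖² = a² (3 (2P + Q + Λ')² + (3Q + Λ')²)` with the integer
`3 (2P + Q + Λ')² + (3Q + Λ')² ≡ Λ'² ≢ 0 (mod 3)`, so its length is never `a` (indeed
`‖·‖² ∈ a² (ℕ + 1/3) = {a²/3, 4a²/3, 7a²/3, …}`): balls of one layer plane sitting over different hollow
sublattices are never at the touching distance.  (Used by the Barlow-tent step count, ROUTE §73.3.) -/

/-- `12 ‖P u + Q v + Λ' w‖² = a² (3 (2P + Q + Λ')² + (3Q + Λ')²)` (the quadratic form of the
hexagonal layer and its three cosets `A, B, C`). [cite: HalesDSP2012, §1.3 (hexagonal layers, the sites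
`A`, `B`, `C` of Fig. 1.12)] -/
theorem twelve_mul_norm_inPlane_sq (a : ℝ) (P Q Λ' : ℤ) :
    12 * ‖(P : ℝ) • triangularVec₁ a + (Q : ℝ) • triangularVec₂ a + (Λ' : ℝ) • barlowOffset a‖ ^ 2 =
      a ^ 2 * ((3 * (2 * P + Q + Λ') ^ 2 + (3 * Q + Λ') ^ 2 : ℤ) : ℝ) := by
  rw [EuclideanSpace.norm_eq, Real.sq_sqrt (Finset.sum_nonneg fun _ _ => sq_nonneg _),
    Fin.sum_univ_three]
  have h3 : (√3 : ℝ) ^ 2 = 3 := Real.sq_sqrt (by norm_num)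
  simp only [PiLp.add_apply, PiLp.smul_apply, smul_eq_mul, triangularVec₁, triangularVec₂,
    barlowOffset, Real.norm_eq_abs, sq_abs]
  simp
  linear_combination (a ^ 2 * (3 * (Q : ℝ) + Λ') ^ 2 / 3) * h3

/-- **Different hollow classes never touch**: if `3 ∤ Λ'` then `‖P u + Q v + Λ' w‖ ≠ a` (`a ≠ 0`):
a `B`-site and a `C`-site over the same `A`-layer are never at the lattice distance.
[cite: HalesDSP2012, §1.3 (Fig. 1.12: the layer above an `A`-layer occupies ALL the `B`-sites or ALL
the `C`-sites)] -/
theorem norm_inPlane_ne_of_not_dvd {a : ℝ} (ha : a ≠ 0) {P Q Λ' : ℤ} (hΛ : ¬ (3 : ℤ) ∣ Λ') :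
    ‖(P : ℝ) • triangularVec₁ a + (Q : ℝ) • triangularVec₂ a + (Λ' : ℝ) • barlowOffset a‖ ≠ a := by
  intro hN
  have h12 := twelve_mul_norm_inPlane_sq a P Q Λ'
  rw [hN] at h12
  have hM : (3 * (2 * P + Q + Λ') ^ 2 + (3 * Q + Λ') ^ 2 : ℤ) = 12 := by
    have h' : (a ^ 2 : ℝ) * ((3 * (2 * P + Q + Λ') ^ 2 + (3 * Q + Λ') ^ 2 : ℤ) : ℝ) = a ^ 2 * 12 := by
      linarith
    exact_mod_cast mul_left_cancel₀ (pow_ne_zero 2 ha) h'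
  apply hΛ
  -- `3 ∣ (3Q + Λ')²` from `hM`, hence `3 ∣ Λ'`
  have h3 : (3 : ℤ) ∣ (3 * Q + Λ') ^ 2 := ⟨4 - (2 * P + Q + Λ') ^ 2, by linarith⟩
  have h3' : (3 : ℤ) ∣ 3 * Q + Λ' := Int.Prime.dvd_pow' (by norm_num) h3
  simpa using (Int.dvd_add_right (Dvd.intro Q rfl)).mp h3'

/-- **The distance set between two hollow classes**: if `3 ∤ Λ'` then `a²/3 ≤ ‖P u + Q v + Λ' w‖²`
(the values are `a²/3, 4a²/3, 7a²/3, …`; `a/√3` = the distance from a site to the nearest hole).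
[cite: HalesDSP2012, §1.3 (Fig. 1.12)] -/
theorem sq_div_three_le_norm_inPlane_sq (a : ℝ) {P Q Λ' : ℤ} (hΛ : ¬ (3 : ℤ) ∣ Λ') :
    a ^ 2 / 3 ≤ ‖(P : ℝ) • triangularVec₁ a + (Q : ℝ) • triangularVec₂ a + (Λ' : ℝ) • barlowOffset a‖ ^ 2 := by
  have h12 := twelve_mul_norm_inPlane_sq a P Q Λ'
  have hne : 3 * Q + Λ' ≠ 0 := fun h0 => hΛ ⟨-Q, by linarith⟩
  have key : ∀ x : ℤ, x ≠ 0 → 1 ≤ x ^ 2 := fun x hx => by nlinarith [Int.one_le_abs hx, sq_abs x]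
  have hM : (4 : ℤ) ≤ 3 * (2 * P + Q + Λ') ^ 2 + (3 * Q + Λ') ^ 2 := by
    rcases Int.even_or_odd (3 * Q + Λ') with ⟨m, hm⟩ | ⟨m, hm⟩
    · -- even and nonzero ⇒ its square is `≥ 4`
      have hm0 : m ≠ 0 := by rintro rfl; simp_all
      have h4 : 4 ≤ (3 * Q + Λ') ^ 2 := by rw [hm]; nlinarith [key m hm0]
      nlinarith [sq_nonneg (2 * P + Q + Λ')]
    · -- odd ⇒ `2P + Q + Λ' = (3Q + Λ') + 2(P − Q)` is odd too; both squares are `≥ 1`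
      have h1 : 1 ≤ (2 * P + Q + Λ') ^ 2 := key _ (by omega)
      have h1' : 1 ≤ (3 * Q + Λ') ^ 2 := key _ hne
      nlinarith
  have hM' : (4 : ℝ) ≤ ((3 * (2 * P + Q + Λ') ^ 2 + (3 * Q + Λ') ^ 2 : ℤ) : ℝ) := by exact_mod_cast hM
  nlinarith [sq_nonneg a]

/-- **Barlow form**: points of the SAME height in two Barlow stackings `s`, `s'` whose letters at
that layer differ (`3 ∤ L_s(k) − L_{s'}(k)`, i.e. the two layers sit over different hollow classes)
are never at distance `a`. [cite: HalesDSP2012, §1.3 (labels `A, B, C` of consecutive layers)] -/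
theorem dist_barlowPos_ne_of_haggLabel_not_congr {a : ℝ} (ha : a ≠ 0) (h : ℝ) (s s' : ℤ → ℤ)
    (k i j i' j' : ℤ) (hΛ : ¬ (3 : ℤ) ∣ haggLabel s k - haggLabel s' k) :
    dist (barlowPos a h s k i j) (barlowPos a h s' k i' j') ≠ a := by
  have hv : barlowPos a h s k i j - barlowPos a h s' k i' j' =
      ((i - i' : ℤ) : ℝ) • triangularVec₁ a + ((j - j' : ℤ) : ℝ) • triangularVec₂ a +
        ((haggLabel s k - haggLabel s' k : ℤ) : ℝ) • barlowOffset a := by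
    simp only [barlowPos]; push_cast; module
  rw [dist_eq_norm, hv]
  exact norm_inPlane_ne_of_not_dvd ha hΛ

#harness_tags norm_inPlane_ne_of_not_dvd

/-! ## Bilayers ARE fcc bilayers, layer by layer (exact form)

The inclusions above upgraded to EQUALITIES, layer by layer, with the height behaviour of the two
motions: every layer of every stacking is a horizontal translate of the fcc layer of the same index
(`barlowLayer_eq_translate_fcc`) and a horizontal translate of the basal mirror image of the fcc layer of
the opposite index (`barlowLayer_eq_mirror_translate_fcc`), unconditionally; for a Hägg sequence the SAME
motion serves the two layers of a bilayer (`+1`: translation, fcc bilayer `(k, k+1)`; `−1`: mirror +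
translation, fcc bilayer `(−k−1, −k)`), and it maps the open slab between the two fcc layers onto the open
slab between layers `k` and `k + 1` (`exists_motion_fccBilayer_eq`).  This is the form in which a cell
complex built on the fcc bilayer (tetrahedra and octahedra between two consecutive close-packed layers,
[cite: FlatleyTheil2015, §3.2 Def. 3.8]) is transported to every bilayer of every Barlow stacking with the
occupied / vacant status of its vertices. -/

/-- Every point of layer `k` of ANY stacking is the fcc point of layer `k` with the same in-layer
coordinates, translated horizontally by `(haggLabel s k − k)·w`. [cite: HalesDSP2012, §1.3];
[cite: ConwaySloane1999, Ch. 1 §1.3] -/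
theorem barlowPos_eq_translate_fcc (a h : ℝ) (s : ℤ → ℤ) (k i j : ℤ) :
    barlowPos a h s k i j =
      barlowPos a h constHagg k i j + ((haggLabel s k : ℝ) - k) • barlowOffset a := by
  simp only [barlowPos, haggLabel_const]
  module

/-- Every point of layer `k` of ANY stacking is the basal mirror image of the fcc point of layer `−k`
with the same in-layer coordinates, translated horizontally by `(haggLabel s k + k)·w`.
[cite: ConwaySloane1999, Ch. 1 §1.3] -/
theorem barlowPos_eq_mirror_translate_fcc (a h : ℝ) (s : ℤ → ℤ) (k i j : ℤ) :
    barlowPos a h s k i j =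
      basalMirror (barlowPos a h constHagg (-k) i j) + ((haggLabel s k : ℝ) + k) • barlowOffset a := by
  rw [basalMirror_barlowPos_constHagg]
  simp only [barlowPos]
  push_cast
  module

/-- **Layer `k` of any stacking is the horizontal translate of fcc layer `k`** (as a SET EQUALITY).
[cite: HalesDSP2012, §1.3]; [cite: ConwaySloane1999, Ch. 1 §1.3] -/
theorem barlowLayer_eq_translate_fcc (a h : ℝ) (s : ℤ → ℤ) (k : ℤ) :
    barlowLayer a h s k =
      (fun r => r + ((haggLabel s k : ℝ) - k) • barlowOffset a) '' barlowLayer a h constHagg k := by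
  ext x
  constructor
  · rintro ⟨i, j, rfl⟩
    exact ⟨barlowPos a h constHagg k i j, ⟨i, j, rfl⟩, (barlowPos_eq_translate_fcc a h s k i j).symm⟩
  · rintro ⟨_, ⟨i, j, rfl⟩, rfl⟩
    exact ⟨i, j, (barlowPos_eq_translate_fcc a h s k i j).symm⟩

/-- **Layer `k` of any stacking is the horizontal translate of the basal mirror image of fcc layer `−k`**
(as a SET EQUALITY). [cite: ConwaySloane1999, Ch. 1 §1.3] -/
theorem barlowLayer_eq_mirror_translate_fcc (a h : ℝ) (s : ℤ → ℤ) (k : ℤ) :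
    barlowLayer a h s k =
      (fun r => basalMirror r + ((haggLabel s k : ℝ) + k) • barlowOffset a) ''
        barlowLayer a h constHagg (-k) := by
  ext x
  constructor
  · rintro ⟨i, j, rfl⟩
    exact ⟨barlowPos a h constHagg (-k) i j, ⟨i, j, rfl⟩,
      (barlowPos_eq_mirror_translate_fcc a h s k i j).symm⟩
  · rintro ⟨_, ⟨i, j, rfl⟩, rfl⟩
    exact ⟨i, j, (barlowPos_eq_mirror_translate_fcc a h s k i j).symm⟩

/-- **Step `+1`, exact**: if `s k = 1`, ONE horizontal translation maps fcc layer `k` ONTO layer `k` and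
fcc layer `k + 1` ONTO layer `k + 1`. [cite: ConwaySloane1999, Ch. 1 §1.3]; [cite: HalesDSP2012, §1.3] -/
theorem barlowBilayer_eq_translate_fcc_of_eq_one (a h : ℝ) (s : ℤ → ℤ) (k : ℤ) (hk : s k = 1) :
    barlowLayer a h s k =
        (fun r => r + ((haggLabel s k : ℝ) - k) • barlowOffset a) '' barlowLayer a h constHagg k ∧
      barlowLayer a h s (k + 1) =
        (fun r => r + ((haggLabel s k : ℝ) - k) • barlowOffset a) '' barlowLayer a h constHagg (k + 1) := by
  refine ⟨barlowLayer_eq_translate_fcc a h s k, ?_⟩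
  have hL : (haggLabel s (k + 1) : ℝ) - (((k + 1 : ℤ) : ℝ)) = (haggLabel s k : ℝ) - k := by
    rw [haggLabel_succ, hk]; push_cast; ring
  rw [barlowLayer_eq_translate_fcc a h s (k + 1), hL]

/-- **Step `−1`, exact**: if `s k = −1`, ONE mirror-translation maps fcc layer `−k` ONTO layer `k` and
fcc layer `−(k + 1)` ONTO layer `k + 1`. [cite: ConwaySloane1999, Ch. 1 §1.3]; [cite: HalesDSP2012, §1.3] -/
theorem barlowBilayer_eq_mirror_translate_fcc_of_eq_neg_one (a h : ℝ) (s : ℤ → ℤ) (k : ℤ)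
    (hk : s k = -1) :
    barlowLayer a h s k =
        (fun r => basalMirror r + ((haggLabel s k : ℝ) + k) • barlowOffset a) ''
          barlowLayer a h constHagg (-k) ∧
      barlowLayer a h s (k + 1) =
        (fun r => basalMirror r + ((haggLabel s k : ℝ) + k) • barlowOffset a) ''
          barlowLayer a h constHagg (-(k + 1)) := by
  refine ⟨barlowLayer_eq_mirror_translate_fcc a h s k, ?_⟩
  have hL : (haggLabel s (k + 1) : ℝ) + (((k + 1 : ℤ) : ℝ)) = (haggLabel s k : ℝ) + k := by
    rw [haggLabel_succ, hk]; push_cast; ring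
  rw [barlowLayer_eq_mirror_translate_fcc a h s (k + 1), hL]

/-- A horizontal translation by a multiple of `w` does not change the height.
[cite: HalesDSP2012, §1.3 (the lateral offset `w` lies in the layer plane)] -/
theorem translate_barlowOffset_apply_two (a c : ℝ) (r : EuclideanSpace ℝ (Fin 3)) :
    (r + c • barlowOffset a) 2 = r 2 := by
  simp [barlowOffset]

/-- The basal mirror followed by a horizontal translation negates the height.
[cite: ConwaySloane1999, Ch. 1 §1.3] -/
theorem basalMirror_translate_barlowOffset_apply_two (a c : ℝ) (r : EuclideanSpace ℝ (Fin 3)) :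
    (basalMirror r + c • barlowOffset a) 2 = -r 2 := by
  simp [barlowOffset, basalMirror_apply_coord]

/-- The basal mirror is an involution. [cite: ConwaySloane1999, Ch. 1 §1.3] -/
theorem basalMirror_basalMirror (r : EuclideanSpace ℝ (Fin 3)) : basalMirror (basalMirror r) = r := by
  rw [basalMirror, Submodule.reflection_reflection]

/-- A horizontal translation maps the open slab between fcc layers `m`, `m + 1` onto itself.
[cite: HalesDSP2012, §1.3] -/
theorem image_translate_barlowOffset_slab (a h c : ℝ) (m : ℤ) :
    (fun r : EuclideanSpace ℝ (Fin 3) => r + c • barlowOffset a) ''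
        {r | (m : ℝ) * h < r 2 ∧ r 2 < ((m : ℝ) + 1) * h} =
      {r | (m : ℝ) * h < r 2 ∧ r 2 < ((m : ℝ) + 1) * h} := by
  ext x
  simp only [Set.mem_image, Set.mem_setOf_eq]
  constructor
  · rintro ⟨r, hr, rfl⟩
    rwa [translate_barlowOffset_apply_two]
  · intro hx
    refine ⟨x + (-c) • barlowOffset a, by rwa [translate_barlowOffset_apply_two], ?_⟩
    rw [add_assoc, ← add_smul, neg_add_cancel, zero_smul, add_zero]

/-- The mirror-translation maps the open slab between fcc layers `−k−1`, `−k` onto the open slab between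
layers `k`, `k + 1`. [cite: ConwaySloane1999, Ch. 1 §1.3] -/
theorem image_basalMirror_translate_barlowOffset_slab (a h c : ℝ) (k : ℤ) :
    (fun r : EuclideanSpace ℝ (Fin 3) => basalMirror r + c • barlowOffset a) ''
        {r | (((-(k + 1) : ℤ)) : ℝ) * h < r 2 ∧ r 2 < ((((-(k + 1) : ℤ)) : ℝ) + 1) * h} =
      {r | (k : ℝ) * h < r 2 ∧ r 2 < ((k : ℝ) + 1) * h} := by
  ext x
  simp only [Set.mem_image, Set.mem_setOf_eq]
  push_cast
  constructor
  · rintro ⟨r, ⟨h1, h2⟩, rfl⟩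
    rw [basalMirror_translate_barlowOffset_apply_two]
    constructor <;> linarith
  · rintro ⟨h1, h2⟩
    refine ⟨basalMirror (x + (-c) • barlowOffset a), ?_, ?_⟩
    · have hx2 : (basalMirror (x + (-c) • barlowOffset a)) 2 = -x 2 := by
        rw [basalMirror_apply_coord]
        simp [barlowOffset]
      rw [hx2]
      constructor <;> linarith
    · rw [basalMirror_basalMirror, add_assoc, ← add_smul, neg_add_cancel, zero_smul, add_zero]

/-- **Every bilayer of a Barlow stacking IS a moved fcc bilayer, with its slab.**  For a Hägg sequence `s`
and every `k` there are a linear isometry `A` (the identity or the basal mirror), a vector `u` and an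
index `m` (`= k` or `= −k−1`) such that the rigid motion `r ↦ A r + u` maps the two fcc layers `m`, `m+1`
ONTO the two layers `k`, `k+1` (as a union) and the open slab `m h < x₃ < (m+1) h` ONTO the open slab
`k h < x₃ < (k+1) h`.  (So any cell decomposition of the fcc bilayer slab with vertices in the two fcc
layers transports to bilayer `k` with the occupied / vacant status of every vertex.)
[cite: ConwaySloane1999, Ch. 1 §1.3 (any two consecutive layers of a Barlow packing are congruent to two
consecutive fcc layers)]; [cite: FlatleyTheil2015, §3.2 Def. 3.8 (the units between two consecutive
layers)] -/
theorem exists_motion_fccBilayer_eq (a h : ℝ) {s : ℤ → ℤ} (hs : IsHaggSeq s) (k : ℤ) :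
    ∃ (A : EuclideanSpace ℝ (Fin 3) ≃ₗᵢ[ℝ] EuclideanSpace ℝ (Fin 3)) (u : EuclideanSpace ℝ (Fin 3))
      (m : ℤ),
      (fun r => A r + u) '' (barlowLayer a h constHagg m ∪ barlowLayer a h constHagg (m + 1)) =
          barlowLayer a h s k ∪ barlowLayer a h s (k + 1) ∧
        (fun r => A r + u) '' {r | (m : ℝ) * h < r 2 ∧ r 2 < ((m : ℝ) + 1) * h} =
          {r | (k : ℝ) * h < r 2 ∧ r 2 < ((k : ℝ) + 1) * h} := by
  rcases hs k with hk | hk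
  · obtain ⟨h0, h1⟩ := barlowBilayer_eq_translate_fcc_of_eq_one a h s k hk
    refine ⟨LinearIsometryEquiv.refl ℝ _, ((haggLabel s k : ℝ) - k) • barlowOffset a, k, ?_, ?_⟩
    · simp only [LinearIsometryEquiv.coe_refl, id_eq, Set.image_union]
      rw [← h0, ← h1]
    · simp only [LinearIsometryEquiv.coe_refl, id_eq]
      exact image_translate_barlowOffset_slab a h _ k
  · obtain ⟨h0, h1⟩ := barlowBilayer_eq_mirror_translate_fcc_of_eq_neg_one a h s k hk
    refine ⟨basalMirror, ((haggLabel s k : ℝ) + k) • barlowOffset a, -(k + 1), ?_, ?_⟩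
    · rw [Set.image_union, show -(k + 1) + 1 = -k by ring, ← h1, ← h0, Set.union_comm]
    · exact image_basalMirror_translate_barlowOffset_slab a h _ k

#harness_tags exists_motion_fccBilayer_eq

/-- fcc layer `m` is fcc layer `0` translated by `m·(w + h e₃)` (pointwise, same in-layer coordinates).
[cite: HalesDSP2012, §1.3 (the walk `A → B → C`)] -/
theorem barlowPos_constHagg_eq_translate_zero (a h : ℝ) (m i j : ℤ) :
    barlowPos a h constHagg m i j =
      barlowPos a h constHagg 0 i j + (m : ℝ) • (barlowOffset a + layerNormal h) := by
  simp only [barlowPos, haggLabel_const]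
  push_cast
  module

/-- fcc layer `m` is the translate of fcc layer `0` by `m·(w + h e₃)` (set equality).
[cite: HalesDSP2012, §1.3] -/
theorem barlowLayer_constHagg_eq_translate_zero (a h : ℝ) (m : ℤ) :
    barlowLayer a h constHagg m =
      (fun r => r + (m : ℝ) • (barlowOffset a + layerNormal h)) '' barlowLayer a h constHagg 0 := by
  ext x
  constructor
  · rintro ⟨i, j, rfl⟩
    exact ⟨barlowPos a h constHagg 0 i j, ⟨i, j, rfl⟩,
      (barlowPos_constHagg_eq_translate_zero a h m i j).symm⟩
  · rintro ⟨_, ⟨i, j, rfl⟩, rfl⟩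
    exact ⟨i, j, (barlowPos_constHagg_eq_translate_zero a h m i j).symm⟩

/-- The translation by `m·(w + h e₃)` raises the height by `m h`. [cite: HalesDSP2012, §1.3] -/
theorem translate_offset_normal_apply_two (a h : ℝ) (m : ℝ) (r : EuclideanSpace ℝ (Fin 3)) :
    (r + m • (barlowOffset a + layerNormal h)) 2 = r 2 + m * h := by
  simp [barlowOffset, layerNormal]

/-- Translating by `m·(w + h e₃)` carries the slab `0 < x₃ < h` onto the slab `m h < x₃ < (m+1) h`.
[cite: HalesDSP2012, §1.3] -/
theorem image_translate_offset_normal_slab_zero (a h : ℝ) (m : ℤ) :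
    (fun r : EuclideanSpace ℝ (Fin 3) => r + (m : ℝ) • (barlowOffset a + layerNormal h)) ''
        {r | 0 < r 2 ∧ r 2 < h} =
      {r | (m : ℝ) * h < r 2 ∧ r 2 < ((m : ℝ) + 1) * h} := by
  ext x
  simp only [Set.mem_image, Set.mem_setOf_eq]
  constructor
  · rintro ⟨r, ⟨h1, h2⟩, rfl⟩
    rw [translate_offset_normal_apply_two]
    constructor <;> linarith
  · rintro ⟨h1, h2⟩
    refine ⟨x + (-(m : ℝ)) • (barlowOffset a + layerNormal h), ?_, ?_⟩
    · rw [translate_offset_normal_apply_two]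
      constructor <;> linarith
    · rw [add_assoc, ← add_smul, neg_add_cancel, zero_smul, add_zero]

/-- **Every bilayer of a Barlow stacking is a moved copy of THE fcc bilayer `(0, 1)`, with its slab**:
for a Hägg sequence `s` and every `k` there is a rigid motion `r ↦ A r + u` mapping fcc layers `0 ∪ 1`
ONTO layers `k ∪ (k+1)` and the open slab `0 < x₃ < h` ONTO the open slab `k h < x₃ < (k+1) h`.
[cite: ConwaySloane1999, Ch. 1 §1.3]; [cite: FlatleyTheil2015, §3.2 Def. 3.8] -/
theorem exists_motion_fccBilayer_zero_eq (a h : ℝ) {s : ℤ → ℤ} (hs : IsHaggSeq s) (k : ℤ) :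
    ∃ (A : EuclideanSpace ℝ (Fin 3) ≃ₗᵢ[ℝ] EuclideanSpace ℝ (Fin 3)) (u : EuclideanSpace ℝ (Fin 3)),
      (fun r => A r + u) '' (barlowLayer a h constHagg 0 ∪ barlowLayer a h constHagg 1) =
          barlowLayer a h s k ∪ barlowLayer a h s (k + 1) ∧
        (fun r => A r + u) '' {r | 0 < r 2 ∧ r 2 < h} =
          {r | (k : ℝ) * h < r 2 ∧ r 2 < ((k : ℝ) + 1) * h} := by
  obtain ⟨A, u, m, hlay, hslab⟩ := exists_motion_fccBilayer_eq a h hs k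
  -- the composite motion `r ↦ A (r + v) + u = A r + (A v + u)`, `v = m (w + h e₃)`
  have hcomp : (fun r : EuclideanSpace ℝ (Fin 3) => A r + (A ((m : ℝ) • (barlowOffset a + layerNormal h)) + u)) =
      (fun r => A r + u) ∘ (fun r => r + (m : ℝ) • (barlowOffset a + layerNormal h)) := by
    funext r; simp [map_add, add_assoc]
  have h0 : (fun r : EuclideanSpace ℝ (Fin 3) => r + (m : ℝ) • (barlowOffset a + layerNormal h)) ''
      barlowLayer a h constHagg 0 = barlowLayer a h constHagg m :=
    (barlowLayer_constHagg_eq_translate_zero a h m).symm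
  have h1 : (fun r : EuclideanSpace ℝ (Fin 3) => r + (m : ℝ) • (barlowOffset a + layerNormal h)) ''
      barlowLayer a h constHagg 1 = barlowLayer a h constHagg (m + 1) := by
    rw [barlowLayer_constHagg_eq_translate_zero a h (m + 1), barlowLayer_constHagg_eq_translate_zero a h 1,
      Set.image_image]
    congr 1
    funext r
    rw [add_assoc, ← add_smul]
    push_cast
    ring_nf
  refine ⟨A, A ((m : ℝ) • (barlowOffset a + layerNormal h)) + u, ?_, ?_⟩
  · rw [hcomp, Set.image_comp, Set.image_union, h0, h1]
    exact hlay
  · rw [hcomp, Set.image_comp, image_translate_offset_normal_slab_zero, hslab]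

/-- **Moved form** (the shape used by the Barlow tent: `stacking L s₀ σ = (L · + s₀) '' barlowStacking`,
`laySlab L s₀ i = (L · + s₀) '' {i h < x₃ < (i+1) h}`): every bilayer of a MOVED Barlow stacking is a
moved copy of the fcc bilayer `(0, 1)` with its slab. [cite: ConwaySloane1999, Ch. 1 §1.3];
[cite: FlatleyTheil2015, §3.2 Def. 3.8] -/
theorem exists_motion_fccBilayer_zero_eq_moved (a h : ℝ) {s : ℤ → ℤ} (hs : IsHaggSeq s)
    (L : EuclideanSpace ℝ (Fin 3) ≃ₗᵢ[ℝ] EuclideanSpace ℝ (Fin 3)) (s₀ : EuclideanSpace ℝ (Fin 3)) (k : ℤ) :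
    ∃ (A : EuclideanSpace ℝ (Fin 3) ≃ₗᵢ[ℝ] EuclideanSpace ℝ (Fin 3)) (u : EuclideanSpace ℝ (Fin 3)),
      (fun r => A r + u) '' (barlowLayer a h constHagg 0 ∪ barlowLayer a h constHagg 1) =
          (fun r => L r + s₀) '' (barlowLayer a h s k ∪ barlowLayer a h s (k + 1)) ∧
        (fun r => A r + u) '' {r | 0 < r 2 ∧ r 2 < h} =
          (fun r => L r + s₀) '' {r | (k : ℝ) * h < r 2 ∧ r 2 < ((k : ℝ) + 1) * h} := by
  obtain ⟨A, u, hlay, hslab⟩ := exists_motion_fccBilayer_zero_eq a h hs k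
  have hcomp : (fun r => (A.trans L) r + (L u + s₀)) = (fun r => L r + s₀) ∘ (fun r => A r + u) := by
    funext r; simp [map_add, add_assoc]
  refine ⟨A.trans L, L u + s₀, ?_, ?_⟩
  · rw [hcomp, Set.image_comp, hlay]
  · rw [hcomp, Set.image_comp, hslab]

#harness_tags exists_motion_fccBilayer_zero_eq_moved

end Literature.MathematicalPhysics.StatisticalMechanics
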